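import Literature.Barriers.SmoothPoincare4.SmallExoticaFrontierReductionLemma8BlockOneProofs
import HarnessLib

/-!
# Akhmedov–Park 2010, Lemma 8, block 1 over PRESCRIBED summand data of `Σ₂ = T # T`

Proof file (theorems only, no definition, no named fact) for the Seiberg–Witten leaf
`Literature.Barriers.SmoothPoincare4.akhmedovPark2010_lemma8_invariants` (A. Akhmedov,
B. D. Park, Invent. Math. 181 (2010) 577–603, §9).  The fibre sum
`X₁(m) = Y₁(1,1) #_ψ Z″(1,m)` of Lemma 8 glues block 1 and block 2 along ONE genus-two surface;
in the tree (`akhmedovPark2010_lemma8_exists_fibreSum_of_smooth_blocks`,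
`akhmedovPark2010_lemma8_invariants_of_blocks_vanKampen`) the two blocks must therefore carry
tubes of the same surface TYPE `F`.  Block 2 (`Σ̄₂ ⊂ T⁴ # ℂℙ²bar`, §3) produces its surface as
a specific connected sum `T # T` of two tori (the resolution neck of
`Literature.Topology.FourManifolds.ResolutionNeck` realises the Kervaire–Milnor neck), so block 1
must be available for ANY surface `F` presented as such a connected sum.  The proofs of
`akhmedovPark2010_lemma8_blockOne_model` / `akhmedovPark2010_lemma8_blockOne`
(`…BlockOneModelProofs.lean`, `…BlockOneProofs.lean`) use of `Σ₂` only the summand data of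
`exists_genusTwoSurface_summands` (`GenusTwoSurfaceSummands.lean`): a closed connected oriented
smooth surface `F` which is a connected sum `T # T` of the torus `T = Rechart f₂ (S¹ × S¹)`, with
the two open smooth embeddings `jA : A → F`, `jB : B → F` of open subsets of `T` covering `F`,
containing the complement of the quarter region `U = {Re z₁ > 0 ∧ Re z₂ > 0}` and glued only
inside `U`.  This file re-runs those two proofs VERBATIM with that data as hypotheses:

* `akhmedovPark2010_lemma8_blockOne_model_of_summands` — the smooth model of `F × T²` with the
  fibre tube and the four torus tubes `a₁ × c′, b₁ × c″, a₂′ × c′, a₂″ × d′`, for a prescribed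
  summand presentation of `F`;
* `akhmedovPark2010_lemma8_blockOne_of_summands` — **block 1 EXISTS over the prescribed
  `F`**: a closed connected `ℤ`-orientable smooth `4`-manifold `Y` (our `Y₁(1,1)`) with `|σ| = 0`
  for all orientations and `e(Y) = 0`, carrying a smooth tube `F × ℝ² → Y` with open range
  (`e(F) = -2`, finitely generated homology).

The originals are the special case of `exists_genusTwoSurface_summands`.
[cite: AkhmedovPark2010, §2, §9 eq. (9.1) and proof of Lemma 8]

## References

* [AkhmedovPark2010] A. Akhmedov, B. D. Park, Invent. Math. 181 (2010) 577–603 =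
  arXiv:math/0701829: §2, §9 eq. (9.1) and the proof of Lemma 8.
* [HatcherAT2002] A. Hatcher, *Algebraic Topology* (2002), Ch. 0 p. 5, Example 2.36.
-/

noncomputable section

open scoped Manifold ContDiff Topology Real
open Set Function Module
open Literature.AlgebraicTopology.SingularHomology
open Literature.Topology.FourManifolds
open Literature.Geometry.Manifold (Rechart)

namespace Literature.Barriers.SmoothPoincare4

/-! ### §21 The smooth model `F × T²` with its five tubes, over prescribed summand data -/

/-- **Block 1 of Akhmedov–Park's `X₁(m)` before its surgeries, over prescribed summand data of
`F = T # T`**: the statement of `akhmedovPark2010_lemma8_blockOne_model` for a GIVEN surface `F`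
presented as a connected sum of two tori glued inside the quarter region (hypotheses = the
output of `exists_genusTwoSurface_summands`), with the same proof.
[cite: AkhmedovPark2010, §2 and §9 eq. (9.1)] [cite: HatcherAT2002, Ch. 0 p. 5 and Example 2.36] -/
theorem akhmedovPark2010_lemma8_blockOne_model_of_summands
    {f₂ : ModelProd (EuclideanSpace ℝ (Fin 1)) (EuclideanSpace ℝ (Fin 1)) ≃ₜ EuclideanSpace ℝ (Fin 2)}
    (hf₂ : ContMDiff ((𝓡 1).prod (𝓡 1)) 𝓘(ℝ, EuclideanSpace ℝ (Fin 2)) ∞ f₂)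
    (hf₂' : ContMDiff 𝓘(ℝ, EuclideanSpace ℝ (Fin 2)) ((𝓡 1).prod (𝓡 1)) ∞ f₂.symm)
    (F : Type) [TopologicalSpace F] [T2Space F] [SecondCountableTopology F]
    [ChartedSpace (EuclideanSpace ℝ (Fin 2)) F] [IsManifold (𝓡 2) ∞ F] [CompactSpace F]
    [ConnectedSpace F] (oF : SmoothOrientation (𝓡 2) F)
    (A B : TopologicalSpace.Opens (Rechart f₂ (Circle × Circle))) (jA : A → F) (jB : B → F)
    (hCS : IsConnectedSum (𝓡 2) (𝓡 2) (𝓡 2) (Rechart f₂ (Circle × Circle))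
      (Rechart f₂ (Circle × Circle)) F)
    (hjA : Manifold.IsSmoothEmbedding (𝓡 2) (𝓡 2) ∞ jA) (hjAo : IsOpen (range jA))
    (hjB : Manifold.IsSmoothEmbedding (𝓡 2) (𝓡 2) ∞ jB) (hjBo : IsOpen (range jB))
    (hAU : {w | ¬ (0 < (((Rechart.out f₂ (Circle × Circle) w).1 : Circle) : ℂ).re ∧
        0 < (((Rechart.out f₂ (Circle × Circle) w).2 : Circle) : ℂ).re)} ⊆ (A : Set _))
    (hBU : {w | ¬ (0 < (((Rechart.out f₂ (Circle × Circle) w).1 : Circle) : ℂ).re ∧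
        0 < (((Rechart.out f₂ (Circle × Circle) w).2 : Circle) : ℂ).re)} ⊆ (B : Set _))
    (hglue : ∀ a b, jA a = jB b →
      (0 < (((Rechart.out f₂ (Circle × Circle) (a : Rechart f₂ (Circle × Circle))).1 :
          Circle) : ℂ).re ∧
        0 < (((Rechart.out f₂ (Circle × Circle) (a : Rechart f₂ (Circle × Circle))).2 :
          Circle) : ℂ).re) ∧
      (0 < (((Rechart.out f₂ (Circle × Circle) (b : Rechart f₂ (Circle × Circle))).1 :
          Circle) : ℂ).re ∧
        0 < (((Rechart.out f₂ (Circle × Circle) (b : Rechart f₂ (Circle × Circle))).2 :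
          Circle) : ℂ).re)) :
    ∃ (F' : Type) (_ : TopologicalSpace F') (_ : T2Space F') (_ : CompactSpace F')
      (_ : ConnectedSpace F') (_ : ChartedSpace (EuclideanSpace ℝ (Fin 2)) F')
      (_ : IsManifold (𝓡 2) ∞ F') (χ₁ χ₂ : F' → Circle)
      (X : Type) (_ : TopologicalSpace X) (_ : T2Space X) (_ : SecondCountableTopology X)
      (_ : CompactSpace X) (_ : ConnectedSpace X) (_ : ChartedSpace (EuclideanSpace ℝ (Fin 4)) X)
      (_ : IsManifold (𝓡 4) ∞ X)
      (T : F × EuclideanSpace ℝ (Fin 2) → X)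
      (T₁ T₂ T₃ T₄ : F' × EuclideanSpace ℝ (Fin 2) → X),
      (FinRelHomology ℤ ℤ F ∅ 4 ∧ relEuler ℤ ℤ F ∅ = -2) ∧ FinRelHomology ℤ ℤ F' ∅ 4 ∧
      ContMDiff (𝓡 2) (𝓡 1) ∞ χ₁ ∧ ContMDiff (𝓡 2) (𝓡 1) ∞ χ₂ ∧
      IsOrientableOver ℤ X 4 ∧ (∀ ν : HomologicalOrientation ℤ X 4, ν.signature.natAbs = 0) ∧
      relEuler ℤ ℤ X ∅ = 0 ∧
      (Manifold.IsSmoothEmbedding ((𝓡 2).prod (𝓡 2)) (𝓡 4) ∞ T ∧ IsOpen (range T)) ∧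
      (Manifold.IsSmoothEmbedding ((𝓡 2).prod (𝓡 2)) (𝓡 4) ∞ T₁ ∧ IsOpen (range T₁)) ∧
      (Manifold.IsSmoothEmbedding ((𝓡 2).prod (𝓡 2)) (𝓡 4) ∞ T₂ ∧ IsOpen (range T₂)) ∧
      (Manifold.IsSmoothEmbedding ((𝓡 2).prod (𝓡 2)) (𝓡 4) ∞ T₃ ∧ IsOpen (range T₃)) ∧
      (Manifold.IsSmoothEmbedding ((𝓡 2).prod (𝓡 2)) (𝓡 4) ∞ T₄ ∧ IsOpen (range T₄)) ∧
      Disjoint (range T) (range T₁) ∧ Disjoint (range T) (range T₂) ∧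
      Disjoint (range T) (range T₃) ∧ Disjoint (range T) (range T₄) ∧
      Disjoint (range T₁) (range T₂) ∧ Disjoint (range T₁) (range T₃) ∧
      Disjoint (range T₁) (range T₄) ∧ Disjoint (range T₂) (range T₃) ∧
      Disjoint (range T₂) (range T₄) ∧ Disjoint (range T₃) (range T₄) := by
  classical
  -- the genus-two surface with its summands (`GenusTwoSurfaceSummands.lean`)
  haveI hT : IsManifold (𝓡 2) ∞ (Rechart f₂ (Circle × Circle)) := Rechart.isManifold f₂ _ hf₂ hf₂'
  haveI : ConnectedSpace (Rechart f₂ (Circle × Circle)) :=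
    inferInstanceAs (ConnectedSpace (Circle × Circle))
  haveI : Fact (Module.finrank ℝ ℂ = 1 + 1) := finrank_real_complex_fact'
  have hjAi : Injective jA := hjA.isEmbedding.injective
  have hjBi : Injective jB := hjB.isEmbedding.injective
  -- orientations: of the torus (a topological group) and of `F`
  obtain ⟨g⟩ : Nonempty (HomologicalOrientation ℤ (EuclideanSpace ℝ (Fin 2)) 2) :=
    isOrientableOver_of_simplyConnectedSpace ℤ (EuclideanSpace ℝ (Fin 2)) (n := 2)
  have hOT' := @isOrientableOver_int_of_isTopologicalGroup 2 (Circle × Circle) _ _ _ _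
    (Rechart.instChartedSpace f₂ (Circle × Circle))
  have hOT : IsOrientableOver ℤ (Rechart f₂ (Circle × Circle)) 2 := hOT'
  obtain ⟨μT⟩ := hOT
  obtain ⟨μF, -, -⟩ := SmoothOrientation.existsUnique_isCompatible_holds (n := 2) (M := F) g oF
  -- `H₁(F) ≅ ℤ⁴`, `e(F) = -2`
  have hHF : FinRelHomology ℤ ℤ F ∅ 4 ∧ relEuler ℤ ℤ F ∅ = -2 := by
    let eC : AddCircle (1 : ℝ) ≃ₜ Circle := AddCircle.homeomorphCircle one_ne_zero
    let eT : (Fin 2 → AddCircle (1 : ℝ)) ≃ₜ Rechart f₂ (Circle × Circle) :=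
      ((Homeomorph.finTwoArrow : (Fin 2 → AddCircle (1 : ℝ)) ≃ₜ
          AddCircle (1 : ℝ) × AddCircle (1 : ℝ)).trans (eC.prodCongr eC)).trans
        (Rechart.outHomeomorph f₂ (Circle × Circle)).symm
    obtain ⟨lin⟩ := nonempty_linearEquiv_singularHomology_realTorus_one (Fin 2)
    have lT : (Fin 2 → ℤ) ≃ₗ[ℤ] singularHomology ℤ ℤ (Rechart f₂ (Circle × Circle)) 1 :=
      lin.trans (singularHomology.mapIso ℤ ℤ eT 1).toLinearEquiv
    obtain ⟨eF⟩ := nonempty_singularHomology_one_iso_biprod_of_isConnectedSum_of_orientation μT μT hCS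
    obtain ⟨l⟩ := nonempty_linearEquiv_of_iso_biprod lT lT eF
    have h4 : Module.finrank ℤ (singularHomology ℤ ℤ F 1) = 4 := by
      rw [← l.finrank_eq, Module.finrank_fintype_fun_eq_card, Fintype.card_fin]
    exact relEuler_surface_of_finrank_one_eq_four F μF h4
  -- the surgery torus `F' = Rechart f₂ (S¹ × S¹)`: finitely generated homology, characters
  have hHF' : FinRelHomology ℤ ℤ (Rechart f₂ (Circle × Circle)) ∅ 4 := by
    let eC : AddCircle (1 : ℝ) ≃ₜ Circle := AddCircle.homeomorphCircle one_ne_zero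
    let e' : AddCircle (1 : ℝ) × AddCircle (1 : ℝ) ≃ₜ Rechart f₂ (Circle × Circle) :=
      (eC.prodCongr eC).trans (Rechart.outHomeomorph f₂ (Circle × Circle)).symm
    have h3 := (FinRelHomology.unitAddCircle_prod_unitAddCircle ℤ ℤ).1.of_homeomorph e'
      (fun _ hx => False.elim hx) (fun _ hx => False.elim hx)
    exact h3.mono (by norm_num)
  have hout₂ : ContMDiff (𝓡 2) ((𝓡 1).prod (𝓡 1)) ∞ (Rechart.out f₂ (Circle × Circle)) :=
    Rechart.contMDiff_out f₂ _ hf₂ hf₂'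
  have hχ₁ : ContMDiff (𝓡 2) (𝓡 1) ∞ fun w => (Rechart.out f₂ (Circle × Circle) w).1 :=
    contMDiff_fst.comp hout₂
  have hχ₂ : ContMDiff (𝓡 2) (𝓡 1) ∞ fun w => (Rechart.out f₂ (Circle × Circle) w).2 :=
    contMDiff_snd.comp hout₂
  -- the four curve tubes in the torus, all outside the quarter region `U`
  obtain ⟨hH₁, hH₁o, hH₁r⟩ := isSmoothEmbedding_horizontalCurveTube hf₂ hf₂' (Circle.exp π)
  obtain ⟨hV₂, hV₂o, hV₂r⟩ := isSmoothEmbedding_verticalCurveTube hf₂ hf₂' (Circle.exp π)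
  obtain ⟨hH₃, hH₃o, hH₃r⟩ := isSmoothEmbedding_horizontalCurveTube hf₂ hf₂' (Circle.exp (3 * π / 4))
  obtain ⟨hH₄, hH₄o, hH₄r⟩ := isSmoothEmbedding_horizontalCurveTube hf₂ hf₂' (Circle.exp (5 * π / 4))
  have hπ₁ : 3 * π / 4 ≤ π := by linarith [Real.pi_pos]
  have hπ₂ : π ≤ 5 * π / 4 := by linarith [Real.pi_pos]
  -- second coordinate of a horizontal tube point, first of a vertical one
  have hHout : ∀ (c : ℝ) (q : Circle × EuclideanSpace ℝ (Fin 1)),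
      (Rechart.out f₂ (Circle × Circle) (Rechart.into f₂ (Circle × Circle)
        (q.1, Circle.exp c * Circle.exp (Real.arctan (q.2 0) / 2)))).2 =
        Circle.exp c * Circle.exp (Real.arctan (q.2 0) / 2) := fun c q => by
    rw [Rechart.out_into]
  have hVout : ∀ (c : ℝ) (q : Circle × EuclideanSpace ℝ (Fin 1)),
      (Rechart.out f₂ (Circle × Circle) (Rechart.into f₂ (Circle × Circle)
        (Circle.exp c * Circle.exp (Real.arctan (q.2 0) / 2), q.1))).1 =
        Circle.exp c * Circle.exp (Real.arctan (q.2 0) / 2) := fun c q => by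
    rw [Rechart.out_into]
  have hmem₁ : ∀ q : Circle × EuclideanSpace ℝ (Fin 1), Rechart.into f₂ (Circle × Circle)
      (q.1, Circle.exp π * Circle.exp (Real.arctan (q.2 0) / 2)) ∈ A := fun q => by
    apply hAU
    intro h
    rw [hHout] at h
    have := re_circleExp_mul_circleExp_arctan_half_neg hπ₁ hπ₂ (q.2 0)
    linarith [h.2]
  have hmem₂ : ∀ q : Circle × EuclideanSpace ℝ (Fin 1), Rechart.into f₂ (Circle × Circle)
      (Circle.exp π * Circle.exp (Real.arctan (q.2 0) / 2), q.1) ∈ A := fun q => by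
    apply hAU
    intro h
    rw [hVout] at h
    have := re_circleExp_mul_circleExp_arctan_half_neg hπ₁ hπ₂ (q.2 0)
    linarith [h.1]
  have hmem₃ : ∀ q : Circle × EuclideanSpace ℝ (Fin 1), Rechart.into f₂ (Circle × Circle)
      (q.1, Circle.exp (3 * π / 4) * Circle.exp (Real.arctan (q.2 0) / 2)) ∈ B := fun q => by
    apply hBU
    intro h
    rw [hHout] at h
    have := re_circleExp_mul_circleExp_arctan_half_neg (c := 3 * π / 4) le_rfl
      (by linarith [Real.pi_pos]) (q.2 0)
    linarith [h.2]
  have hmem₄ : ∀ q : Circle × EuclideanSpace ℝ (Fin 1), Rechart.into f₂ (Circle × Circle)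
      (q.1, Circle.exp (5 * π / 4) * Circle.exp (Real.arctan (q.2 0) / 2)) ∈ B := fun q => by
    apply hBU
    intro h
    rw [hHout] at h
    have := re_circleExp_mul_circleExp_arctan_half_neg (c := 5 * π / 4)
      (by linarith [Real.pi_pos]) le_rfl (q.2 0)
    linarith [h.2]
  -- the curve tubes in `F`: `a₁`, `b₁` through `jA`, `a₂′`, `a₂″` through `jB`
  have hcurve : ∀ (W : TopologicalSpace.Opens (Rechart f₂ (Circle × Circle))) (j : W → F)
      (hj : Manifold.IsSmoothEmbedding (𝓡 2) (𝓡 2) ∞ j) (hjo : IsOpen (range j))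
      (H : Circle × EuclideanSpace ℝ (Fin 1) → Rechart f₂ (Circle × Circle))
      (hH : Manifold.IsSmoothEmbedding ((𝓡 1).prod (𝓡 1)) (𝓡 2) ∞ H) (hHo : IsOpen (range H))
      (hW : ∀ q, H q ∈ W),
      Manifold.IsSmoothEmbedding ((𝓡 1).prod (𝓡 1)) (𝓡 2) ∞ (j ∘ fun q => (⟨H q, hW q⟩ : W)) ∧
        IsOpen (range (j ∘ fun q => (⟨H q, hW q⟩ : W))) := by
    intro W j hj hjo H hH hHo hW
    have hg : Manifold.IsSmoothEmbedding ((𝓡 1).prod (𝓡 1)) (𝓡 2) ∞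
        (fun q => (⟨H q, hW q⟩ : W)) := hH.opensCodRestrict W hW
    have hgo : IsOpen (range fun q => (⟨H q, hW q⟩ : W)) := by
      have : range (fun q => (⟨H q, hW q⟩ : W)) = Subtype.val ⁻¹' range H := by
        ext a
        constructor
        · rintro ⟨x, rfl⟩; exact ⟨x, rfl⟩
        · rintro ⟨x, hx⟩; exact ⟨x, Subtype.ext hx⟩
      rw [this]
      exact hHo.preimage continuous_subtype_val
    obtain ⟨h1, h2⟩ :=
      isSmoothEmbedding_comp_of_isOpen_range_of_isSmoothEmbedding (k := 1) hj hjo hg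
    exact ⟨h1, h2 hgo⟩
  obtain ⟨hγ₁, hγ₁o⟩ := hcurve A jA hjA hjAo _ hH₁ hH₁o hmem₁
  obtain ⟨hγ₂, hγ₂o⟩ := hcurve A jA hjA hjAo _ hV₂ hV₂o hmem₂
  obtain ⟨hγ₃, hγ₃o⟩ := hcurve B jB hjB hjBo _ hH₃ hH₃o hmem₃
  obtain ⟨hγ₄, hγ₄o⟩ := hcurve B jB hjB hjBo _ hH₄ hH₄o hmem₄
  -- curves of different summands are disjoint in `F` (the summands are glued inside `U`)
  have hdisjAB : ∀ (HA HB : Circle × EuclideanSpace ℝ (Fin 1) → Rechart f₂ (Circle × Circle))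
      (hWA : ∀ q, HA q ∈ A) (hWB : ∀ q, HB q ∈ B)
      (hUA : ∀ q, ¬ (0 < (((Rechart.out f₂ (Circle × Circle) (HA q)).1 : Circle) : ℂ).re ∧
        0 < (((Rechart.out f₂ (Circle × Circle) (HA q)).2 : Circle) : ℂ).re)),
      Disjoint (range (jA ∘ fun q => (⟨HA q, hWA q⟩ : A)))
        (range (jB ∘ fun q => (⟨HB q, hWB q⟩ : B))) := by
    intro HA HB hWA hWB hUA
    refine Set.disjoint_left.2 ?_
    rintro _ ⟨q, rfl⟩ ⟨q', hq'⟩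
    exact hUA q (hglue _ _ hq'.symm).1
  have hUA₁ : ∀ q : Circle × EuclideanSpace ℝ (Fin 1),
      ¬ (0 < (((Rechart.out f₂ (Circle × Circle) (Rechart.into f₂ (Circle × Circle)
          (q.1, Circle.exp π * Circle.exp (Real.arctan (q.2 0) / 2)))).1 : Circle) : ℂ).re ∧
        0 < (((Rechart.out f₂ (Circle × Circle) (Rechart.into f₂ (Circle × Circle)
          (q.1, Circle.exp π * Circle.exp (Real.arctan (q.2 0) / 2)))).2 : Circle) : ℂ).re) :=
    fun q h => by
      rw [hHout] at h
      have := re_circleExp_mul_circleExp_arctan_half_neg hπ₁ hπ₂ (q.2 0)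
      linarith [h.2]
  have hUA₂ : ∀ q : Circle × EuclideanSpace ℝ (Fin 1),
      ¬ (0 < (((Rechart.out f₂ (Circle × Circle) (Rechart.into f₂ (Circle × Circle)
          (Circle.exp π * Circle.exp (Real.arctan (q.2 0) / 2), q.1))).1 : Circle) : ℂ).re ∧
        0 < (((Rechart.out f₂ (Circle × Circle) (Rechart.into f₂ (Circle × Circle)
          (Circle.exp π * Circle.exp (Real.arctan (q.2 0) / 2), q.1))).2 : Circle) : ℂ).re) :=
    fun q h => by
      rw [hVout] at h
      have := re_circleExp_mul_circleExp_arctan_half_neg hπ₁ hπ₂ (q.2 0)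
      linarith [h.1]
  have hd13 := hdisjAB _ _ hmem₁ hmem₃ hUA₁
  have hd14 := hdisjAB _ _ hmem₁ hmem₄ hUA₁
  have hd23 := hdisjAB _ _ hmem₂ hmem₃ hUA₂
  have hd24 := hdisjAB _ _ hmem₂ hmem₄ hUA₂
  -- the two parallel circles `a₂′`, `a₂″` are disjoint (their arcs have `Im > 0`, `Im < 0`)
  have hd34 : Disjoint
      (range (jB ∘ fun q : Circle × EuclideanSpace ℝ (Fin 1) =>
        (⟨Rechart.into f₂ (Circle × Circle)
          (q.1, Circle.exp (3 * π / 4) * Circle.exp (Real.arctan (q.2 0) / 2)), hmem₃ q⟩ : B)))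
      (range (jB ∘ fun q : Circle × EuclideanSpace ℝ (Fin 1) =>
        (⟨Rechart.into f₂ (Circle × Circle)
          (q.1, Circle.exp (5 * π / 4) * Circle.exp (Real.arctan (q.2 0) / 2)), hmem₄ q⟩ : B))) := by
    refine Set.disjoint_left.2 ?_
    rintro _ ⟨q, rfl⟩ ⟨q', hq'⟩
    have h := congrArg (fun w : B => (Rechart.out f₂ (Circle × Circle) (w : Rechart f₂ (Circle × Circle))).2)
      (hjBi hq')
    dsimp only at h
    rw [hHout, hHout] at h
    have h₁ := im_circleExp_mul_circleExp_arctan_half_pos (c := 3 * π / 4)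
      (by linarith [Real.pi_pos]) le_rfl (q.2 0)
    have h₂ := im_circleExp_mul_circleExp_arctan_half_neg (c := 5 * π / 4) le_rfl
      (by linarith [Real.pi_pos]) (q'.2 0)
    rw [h] at h₂
    linarith
  -- the model `X ≅ (F × S¹) × S¹` (`SurfaceTimesTorusTube.lean`)
  obtain ⟨X, _, _, _, _, hX, _, _, e, T, g₀, ⟨hTe, hTo, -, -, -, -⟩, ⟨he, he'⟩, -, hTr, hσ, hO,
    hfin⟩ := exists_surface_prod_torus_smooth_model F
  have hσ' : ∀ ν : HomologicalOrientation ℤ X 4, ν.signature.natAbs = 0 := fun ν => by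
    rw [hσ ν]; rfl
  have hOX : IsOrientableOver ℤ X 4 := hO ⟨μF⟩
  have heX : relEuler ℤ ℤ X ∅ = 0 := (hfin 4 hHF.1).2
  -- the swapped model for the `d′` torus
  let τh : (F × Circle) × Circle ≃ₜ (F × Circle) × Circle :=
  { toFun := fun y => (((y.1.1, y.2) : F × Circle), y.1.2)
    invFun := fun y => (((y.1.1, y.2) : F × Circle), y.1.2)
    left_inv := fun _ => rfl
    right_inv := fun _ => rfl
    continuous_toFun := continuous_swapCircles
    continuous_invFun := continuous_swapCircles }
  let e₄ : X ≃ₜ (F × Circle) × Circle := e.trans τh.symm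
  have he₄ : ContMDiff (𝓡 4) (((𝓡 2).prod (𝓡 1)).prod (𝓡 1)) ∞ e₄ :=
    contMDiff_swapCircles.comp he
  have he₄' : ContMDiff (((𝓡 2).prod (𝓡 1)).prod (𝓡 1)) (𝓡 4) ∞ e₄.symm :=
    he'.comp contMDiff_swapCircles
  -- the four torus tubes (`SurfaceTimesTorusTori.lean`)
  obtain ⟨hT₁e, hT₁o, hT₁r⟩ := isSmoothEmbedding_torusTube hf₂ hf₂' hγ₁ hγ₁o e he he'
    (Circle.exp (3 * π / 4))
  obtain ⟨hT₂e, hT₂o, hT₂r⟩ := isSmoothEmbedding_torusTube hf₂ hf₂' hγ₂ hγ₂o e he he'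
    (Circle.exp (5 * π / 4))
  obtain ⟨hT₃e, hT₃o, hT₃r⟩ := isSmoothEmbedding_torusTube hf₂ hf₂' hγ₃ hγ₃o e he he'
    (Circle.exp (3 * π / 4))
  obtain ⟨hT₄e, hT₄o, hT₄r⟩ := isSmoothEmbedding_torusTube hf₂ hf₂' hγ₄ hγ₄o e₄ he₄ he₄'
    (Circle.exp π)
  -- sign facts on the arcs of `(e x).2`, `(e x).1.2`
  have harc_re : ∀ {c : ℝ} (_ : 3 * π / 4 ≤ c) (_ : c ≤ 5 * π / 4) {z : Circle},
      0 < (((z * (Circle.exp c)⁻¹ : Circle)) : ℂ).re →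
      0 < ((((z * (Circle.exp c)⁻¹ : Circle)) : ℂ) ^ 2).re → (z : ℂ).re < 0 := by
    intro c hc₁ hc₂ z h₁ h₂
    obtain ⟨s, rfl⟩ := eq_circleExp_mul_of_mem_quarterArc c h₁ h₂
    exact re_circleExp_mul_circleExp_arctan_half_neg hc₁ hc₂ s
  have harc_im₃ : ∀ {z : Circle}, 0 < (((z * (Circle.exp (3 * π / 4))⁻¹ : Circle)) : ℂ).re →
      0 < ((((z * (Circle.exp (3 * π / 4))⁻¹ : Circle)) : ℂ) ^ 2).re → 0 < (z : ℂ).im := by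
    intro z h₁ h₂
    obtain ⟨s, rfl⟩ := eq_circleExp_mul_of_mem_quarterArc _ h₁ h₂
    exact im_circleExp_mul_circleExp_arctan_half_pos (by linarith [Real.pi_pos]) le_rfl s
  have harc_im₅ : ∀ {z : Circle}, 0 < (((z * (Circle.exp (5 * π / 4))⁻¹ : Circle)) : ℂ).re →
      0 < ((((z * (Circle.exp (5 * π / 4))⁻¹ : Circle)) : ℂ) ^ 2).re → (z : ℂ).im < 0 := by
    intro z h₁ h₂
    obtain ⟨s, rfl⟩ := eq_circleExp_mul_of_mem_quarterArc _ h₁ h₂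
    exact im_circleExp_mul_circleExp_arctan_half_neg le_rfl (by linarith [Real.pi_pos]) s
  -- disjointness
  have hD01 : Disjoint (range T) (range _) := Set.disjoint_left.2 fun x hx hx' => by
    have h := (hTr x).1 hx
    have h' := (Set.ext_iff.1 hT₁r x).1 hx'
    have := harc_re le_rfl (by linarith [Real.pi_pos]) h'.2.1 h'.2.2
    linarith [h.2]
  have hD02 : Disjoint (range T) (range _) := Set.disjoint_left.2 fun x hx hx' => by
    have h := (hTr x).1 hx
    have h' := (Set.ext_iff.1 hT₂r x).1 hx'
    have := harc_re (by linarith [Real.pi_pos]) le_rfl h'.2.1 h'.2.2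
    linarith [h.2]
  have hD03 : Disjoint (range T) (range _) := Set.disjoint_left.2 fun x hx hx' => by
    have h := (hTr x).1 hx
    have h' := (Set.ext_iff.1 hT₃r x).1 hx'
    have := harc_re le_rfl (by linarith [Real.pi_pos]) h'.2.1 h'.2.2
    linarith [h.2]
  have hD04 : Disjoint (range T) (range _) := Set.disjoint_left.2 fun x hx hx' => by
    have h := (hTr x).1 hx
    have h' := (Set.ext_iff.1 hT₄r x).1 hx'
    have : (((e x).1.2 : Circle) : ℂ).re < 0 := harc_re hπ₁ hπ₂ h'.2.1 h'.2.2
    linarith [h.1]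
  have hD12 : Disjoint (range _) (range _) := Set.disjoint_left.2 fun x hx hx' => by
    have h := (Set.ext_iff.1 hT₁r x).1 hx
    have h' := (Set.ext_iff.1 hT₂r x).1 hx'
    have h₁ := harc_im₃ h.2.1 h.2.2
    have h₂ := harc_im₅ h'.2.1 h'.2.2
    linarith
  have hD13 : Disjoint (range _) (range _) := Set.disjoint_left.2 fun x hx hx' => by
    have h := (Set.ext_iff.1 hT₁r x).1 hx
    have h' := (Set.ext_iff.1 hT₃r x).1 hx'
    exact Set.disjoint_left.1 hd13 h.1 h'.1
  have hD14 : Disjoint (range _) (range _) := Set.disjoint_left.2 fun x hx hx' => by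
    have h := (Set.ext_iff.1 hT₁r x).1 hx
    have h' := (Set.ext_iff.1 hT₄r x).1 hx'
    exact Set.disjoint_left.1 hd14 h.1 h'.1
  have hD23 : Disjoint (range _) (range _) := Set.disjoint_left.2 fun x hx hx' => by
    have h := (Set.ext_iff.1 hT₂r x).1 hx
    have h' := (Set.ext_iff.1 hT₃r x).1 hx'
    exact Set.disjoint_left.1 hd23 h.1 h'.1
  have hD24 : Disjoint (range _) (range _) := Set.disjoint_left.2 fun x hx hx' => by
    have h := (Set.ext_iff.1 hT₂r x).1 hx
    have h' := (Set.ext_iff.1 hT₄r x).1 hx'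
    exact Set.disjoint_left.1 hd24 h.1 h'.1
  have hD34 : Disjoint (range _) (range _) := Set.disjoint_left.2 fun x hx hx' => by
    have h := (Set.ext_iff.1 hT₃r x).1 hx
    have h' := (Set.ext_iff.1 hT₄r x).1 hx'
    exact Set.disjoint_left.1 hd34 h.1 h'.1
  exact ⟨Rechart f₂ (Circle × Circle), inferInstance, inferInstance,
    inferInstance, inferInstance, inferInstance, hT, _, _, X, inferInstance, inferInstance,
    inferInstance, inferInstance, inferInstance, inferInstance, hX, T, _, _, _, _, hHF, hHF',
    hχ₁, hχ₂, hOX, hσ', heX, ⟨hTe, hTo⟩, ⟨hT₁e, hT₁o⟩, ⟨hT₂e, hT₂o⟩, ⟨hT₃e, hT₃o⟩, ⟨hT₄e, hT₄o⟩,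
    hD01, hD02, hD03, hD04, hD12, hD13, hD14, hD23, hD24, hD34⟩


/-! ### §22 Block 1 EXISTS over prescribed summand data -/

/-- **Block 1 exists over a prescribed surface `F = T # T`**: the statement of
`akhmedovPark2010_lemma8_blockOne` for a GIVEN `F` with summand data (the four rotation torus
surgeries `(a₁′ × c′, a₁′, -1)`, `(b₁′ × c″, b₁′, -1)`, `(a₂′ × c′, c′, +1)`, `(a₂″ × d′, d′, +1)`
performed on the model of §21, transporting the fibre tube), with the same proof.
[cite: AkhmedovPark2010, §2, §9 eq. (9.1) and proof of Lemma 8] -/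
theorem akhmedovPark2010_lemma8_blockOne_of_summands
    {f₂ : ModelProd (EuclideanSpace ℝ (Fin 1)) (EuclideanSpace ℝ (Fin 1)) ≃ₜ EuclideanSpace ℝ (Fin 2)}
    (hf₂ : ContMDiff ((𝓡 1).prod (𝓡 1)) 𝓘(ℝ, EuclideanSpace ℝ (Fin 2)) ∞ f₂)
    (hf₂' : ContMDiff 𝓘(ℝ, EuclideanSpace ℝ (Fin 2)) ((𝓡 1).prod (𝓡 1)) ∞ f₂.symm)
    (F : Type) [TopologicalSpace F] [T2Space F] [SecondCountableTopology F]
    [ChartedSpace (EuclideanSpace ℝ (Fin 2)) F] [IsManifold (𝓡 2) ∞ F] [CompactSpace F]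
    [ConnectedSpace F] (oF : SmoothOrientation (𝓡 2) F)
    (A B : TopologicalSpace.Opens (Rechart f₂ (Circle × Circle))) (jA : A → F) (jB : B → F)
    (hCS : IsConnectedSum (𝓡 2) (𝓡 2) (𝓡 2) (Rechart f₂ (Circle × Circle))
      (Rechart f₂ (Circle × Circle)) F)
    (hjA : Manifold.IsSmoothEmbedding (𝓡 2) (𝓡 2) ∞ jA) (hjAo : IsOpen (range jA))
    (hjB : Manifold.IsSmoothEmbedding (𝓡 2) (𝓡 2) ∞ jB) (hjBo : IsOpen (range jB))
    (hAU : {w | ¬ (0 < (((Rechart.out f₂ (Circle × Circle) w).1 : Circle) : ℂ).re ∧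
        0 < (((Rechart.out f₂ (Circle × Circle) w).2 : Circle) : ℂ).re)} ⊆ (A : Set _))
    (hBU : {w | ¬ (0 < (((Rechart.out f₂ (Circle × Circle) w).1 : Circle) : ℂ).re ∧
        0 < (((Rechart.out f₂ (Circle × Circle) w).2 : Circle) : ℂ).re)} ⊆ (B : Set _))
    (hglue : ∀ a b, jA a = jB b →
      (0 < (((Rechart.out f₂ (Circle × Circle) (a : Rechart f₂ (Circle × Circle))).1 :
          Circle) : ℂ).re ∧
        0 < (((Rechart.out f₂ (Circle × Circle) (a : Rechart f₂ (Circle × Circle))).2 :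
          Circle) : ℂ).re) ∧
      (0 < (((Rechart.out f₂ (Circle × Circle) (b : Rechart f₂ (Circle × Circle))).1 :
          Circle) : ℂ).re ∧
        0 < (((Rechart.out f₂ (Circle × Circle) (b : Rechart f₂ (Circle × Circle))).2 :
          Circle) : ℂ).re)) :
    ∃ (Y : Type) (_ : TopologicalSpace Y) (_ : T2Space Y) (_ : SecondCountableTopology Y)
      (_ : CompactSpace Y) (_ : ConnectedSpace Y) (_ : ChartedSpace (EuclideanSpace ℝ (Fin 4)) Y)
      (_ : IsManifold (𝓡 4) ∞ Y) (TY : F × EuclideanSpace ℝ (Fin 2) → Y),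
      (FinRelHomology ℤ ℤ F ∅ 4 ∧ relEuler ℤ ℤ F ∅ = -2) ∧ IsOrientableOver ℤ Y 4 ∧
      (∀ ν : HomologicalOrientation ℤ Y 4, ν.signature.natAbs = 0) ∧ relEuler ℤ ℤ Y ∅ = 0 ∧
      Manifold.IsSmoothEmbedding ((𝓡 2).prod (𝓡 2)) (𝓡 4) ∞ TY ∧ IsOpen (range TY) := by
  obtain ⟨F', _, _, _, _, _, _, χ₁, χ₂, X, _, _, _, _, _, _, _, T, T₁, T₂,
    T₃, T₄, hHF, hHF', hχ₁, hχ₂, hOX, hσX, heX, hT, hT₁, hT₂, hT₃, hT₄, hD01, hD02, hD03, hD04,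
    hD12, hD13, hD14, hD23, hD24, hD34⟩ :=
    akhmedovPark2010_lemma8_blockOne_model_of_summands hf₂ hf₂' F oF A B jA jB hCS hjA hjAo hjB
      hjBo hAU hBU hglue
  have hχ₁' : ContMDiff (𝓡 2) (𝓡 1) ∞ fun w => (χ₁ w)⁻¹ := hχ₁.inv
  -- step 1: surgery on `T₁` (`(a₁′ × c′, a₁′, -1)`), transporting `T`, `T₂`, `T₃`, `T₄`
  obtain ⟨P₁, _, _, _, _, _, _, _, U₁, S₁, hO₁, hσ₁, he₁, hU₁, hS₁, hUS₁, hSS₁⟩ :=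
    akhmedovPark2010_lemma8_rotation_step_transport (ι := Fin 3) hHF' hT₁.1 hT₁.2 hχ₁' hOX hσX
      hT.1 hT.2 hD01 (S := ![T₂, T₃, T₄])
      (fun i => by fin_cases i <;> assumption)
      (fun i => by
        fin_cases i
        · exact hD12.symm
        · exact hD13.symm
        · exact hD14.symm)
      (fun i => by
        fin_cases i
        · exact hD02
        · exact hD03
        · exact hD04)
      (fun i j hij => by
        fin_cases i <;> fin_cases j
        · exact absurd rfl hij
        · exact hD23
        · exact hD24
        · exact hD23.symm
        · exact absurd rfl hij
        · exact hD34
        · exact hD24.symm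
        · exact hD34.symm
        · exact absurd rfl hij)
  -- step 2: surgery on the transported `T₂` (`(b₁′ × c″, b₁′, -1)`), transporting `T`, `T₃`, `T₄`
  obtain ⟨P₂, _, _, _, _, _, _, _, U₂, S₂, hO₂, hσ₂, he₂, hU₂, hS₂, hUS₂, hSS₂⟩ :=
    akhmedovPark2010_lemma8_rotation_step_transport (ι := Fin 2) hHF' (hS₁ 0).1 (hS₁ 0).2 hχ₁'
      hO₁ hσ₁ hU₁.1 hU₁.2 (hUS₁ 0) (S := ![S₁ 1, S₁ 2])
      (fun i => by fin_cases i <;> exact hS₁ _)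
      (fun i => by
        fin_cases i
        · exact hSS₁ 1 0 (by decide)
        · exact hSS₁ 2 0 (by decide))
      (fun i => by
        fin_cases i
        · exact hUS₁ 1
        · exact hUS₁ 2)
      (fun i j hij => by
        fin_cases i <;> fin_cases j
        · exact absurd rfl hij
        · exact hSS₁ 1 2 (by decide)
        · exact hSS₁ 2 1 (by decide)
        · exact absurd rfl hij)
  -- step 3: surgery on the transported `T₃` (`(a₂′ × c′, c′, +1)`), transporting `T`, `T₄`
  obtain ⟨P₃, _, _, _, _, _, _, _, U₃, S₃, hO₃, hσ₃, he₃, hU₃, hS₃, hUS₃, hSS₃⟩ :=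
    akhmedovPark2010_lemma8_rotation_step_transport (ι := Fin 1) hHF' (hS₂ 0).1 (hS₂ 0).2 hχ₂
      hO₂ hσ₂ hU₂.1 hU₂.2 (hUS₂ 0) (S := ![S₂ 1])
      (fun i => by fin_cases i; exact hS₂ _)
      (fun i => by
        fin_cases i
        exact hSS₂ 1 0 (by decide))
      (fun i => by
        fin_cases i
        exact hUS₂ 1)
      (fun i j hij => by
        fin_cases i; fin_cases j
        exact absurd rfl hij)
  -- step 4: surgery on the transported `T₄` (`(a₂″ × d′, d′, +1)`), transporting `T`
  obtain ⟨P₄, _, _, _, _, _, _, _, U₄, S₄, hO₄, hσ₄, he₄, hU₄, -, -, -⟩ :=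
    akhmedovPark2010_lemma8_rotation_step_transport (ι := Fin 0) hHF' (hS₃ 0).1 (hS₃ 0).2 hχ₂
      hO₃ hσ₃ hU₃.1 hU₃.2 (hUS₃ 0) (S := fun i => i.elim0)
      (fun i => i.elim0) (fun i => i.elim0) (fun i => i.elim0) (fun i => i.elim0)
  refine ⟨P₄, inferInstance, inferInstance, inferInstance, inferInstance,
    inferInstance, inferInstance, inferInstance, U₄, hHF, hO₄, hσ₄, ?_, hU₄.1, hU₄.2⟩
  rw [he₄, he₃, he₂, he₁, heX]


end Literature.Barriers.SmoothPoincare4
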